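import Summits.CriticalPhenomena.PercolationContinuityZ3.Theorems.Transplant.SkelKitResiduesMWO
import Summits.CriticalPhenomena.PercolationContinuityZ3.Theorems.Transplant.SkelNeg1ChoiceOW
import Summits.CriticalPhenomena.PercolationContinuityZ3.Theorems.Transplant.KNLevelsTargetLemmaAdditive
import Summits.CriticalPhenomena.PercolationContinuityZ3.Theorems.Transplant.KNCellsSchemeO
import Summits.CriticalPhenomena.PercolationContinuityZ3.Theorems.Transplant.KNCellsProcessO
import Summits.CriticalPhenomena.PercolationContinuityZ3.Theorems.Transplant.KNCellsRunO
import Summits.CriticalPhenomena.PercolationContinuityZ3.Theorems.Transplant.KNCellsRunInvO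
import Summits.CriticalPhenomena.PercolationContinuityZ3.Theorems.Transplant.KNCells2SchemeO
import Summits.CriticalPhenomena.PercolationContinuityZ3.Theorems.Transplant.KNCells2RunO
import Summits.CriticalPhenomena.PercolationContinuityZ3.Theorems.Transplant.KNCells2RunInvO
import Summits.CriticalPhenomena.PercolationContinuityZ3.Theorems.Transplant.KNCellsCoverO
import Summits.CriticalPhenomena.PercolationContinuityZ3.Theorems.Transplant.KNCells2CoverO
import Summits.CriticalPhenomena.PercolationContinuityZ3.Theorems.Transplant.KNCellsReachO
import Summits.CriticalPhenomena.PercolationContinuityZ3.Theorems.Transplant.KNCells2ReachO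
import Summits.CriticalPhenomena.PercolationContinuityZ3.Theorems.Transplant.KNCellsExitO
import Summits.CriticalPhenomena.PercolationContinuityZ3.Theorems.Transplant.KNCells2ExitO
import Summits.CriticalPhenomena.PercolationContinuityZ3.Theorems.Transplant.KNCellsStepsDefsO
import Summits.CriticalPhenomena.PercolationContinuityZ3.Theorems.Transplant.KNCellsStepsReachO
import Summits.CriticalPhenomena.PercolationContinuityZ3.Theorems.Transplant.KNCellsStepsPinO
import Summits.CriticalPhenomena.PercolationContinuityZ3.Theorems.Transplant.KNCellsStepsSubboxO
import Summits.CriticalPhenomena.PercolationContinuityZ3.Theorems.Transplant.KNCellsStepsChainO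
import Summits.CriticalPhenomena.PercolationContinuityZ3.Theorems.Transplant.KNCellsStepsFailO
import Summits.CriticalPhenomena.PercolationContinuityZ3.Theorems.Transplant.KNCells2StepsO
import Summits.CriticalPhenomena.PercolationContinuityZ3.Theorems.Transplant.KNCells2FailO
import Summits.CriticalPhenomena.PercolationContinuityZ3.Theorems.Transplant.KNCells2FacePrefixO
import Summits.CriticalPhenomena.PercolationContinuityZ3.Theorems.Transplant.KNCells2ThetaPosChosenO
import Summits.CriticalPhenomena.PercolationContinuityZ3.Theorems.Transplant.KNCells2AnchorNormO
import Summits.CriticalPhenomena.PercolationContinuityZ3.Theorems.Transplant.KNCells2KitAtRunO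
import Summits.CriticalPhenomena.PercolationContinuityZ3.Theorems.Transplant.KNCells2CorridorO
import Summits.CriticalPhenomena.PercolationContinuityZ3.Theorems.Transplant.KNCells2CorridorEdgeO
import Summits.CriticalPhenomena.PercolationContinuityZ3.Theorems.Transplant.KNCells2SepQO
import Summits.CriticalPhenomena.PercolationContinuityZ3.Theorems.Transplant.KNCells2RootChainO
import Summits.CriticalPhenomena.PercolationContinuityZ3.Theorems.Transplant.KNCells2TubeSubO
import Summits.CriticalPhenomena.PercolationContinuityZ3.Theorems.Transplant.SkelTubeSubO
import Summits.CriticalPhenomena.PercolationContinuityZ3.Theorems.Transplant.SkelWinPackagingO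
import Summits.CriticalPhenomena.PercolationContinuityZ3.Theorems.Transplant.SkelKitResiduesO
import Summits.CriticalPhenomena.PercolationContinuityZ3.Theorems.Transplant.SkelPhiFaceResidueO
import Summits.CriticalPhenomena.PercolationContinuityZ3.Theorems.Transplant.SkelKitResiduesHabNO
import Summits.CriticalPhenomena.PercolationContinuityZ3.Theorems.Transplant.SkelRootSeedLawO
import Summits.CriticalPhenomena.PercolationContinuityZ3.Theorems.Transplant.SkelNeg1ClosureA
import Literature.Probability.Percolation.OrientedHistorySiteRenormalizationRun
import HarnessLib

/-!
# N2 (frames-only node `SamePDropOfSkeletonFrm₁`, OPEN) — ORIENTED MACRO LAYER (WAVE 0 (c1), (R-18) `q ≡ true`): the oriented twin of N1's `SkelNeg1ClosureA`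

builds on p205010 (kernel theorem, internal audit signed; external expert review pending) — nothing in this file uses p205010; NOTHING is claimed about the
open node `SamePDropOfSkeletonFrm₁` (`SamePDropOfSkeletonNeg₁` is CLOSED in the tree and untouched by this file).
Status sentence (coordinator 2026-08-20T04:30Z): "θ(p_c) = 0 on ℤ^d, all d ≥ 2 — kernel-verified (Lean 4/Mathlib, standard axioms); internal adversarial
audit SIGNED 2026-08-20 04:29Z; external expert review pending."
Lane `prim-bschramm-*`, seat `prim-bschramm-stmt` (gen 19); helper file (`--supports stmt-CriticalPhenomena-4575 --as helper`); N2-SCOPE §20, (R-18)/(R-19).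
PORT RULES (HOME/prim-bschramm-stmt-g19/lean/port_orient.py): the history-site API is replaced by its ORIENTED twin at the fixed quadrant `qNE := fun _ => true`
(`HState.choice ↦ HState.ochoice qNE`, `mstOf ↦ omstOf qNE`, `mst/stN ↦ omst/ostN qNE`, `occFinal ↦ ooccFinal qNE`, `Lawful ↦ OLawful qNE`, onward directions
`onward ↦ onwardO` = the POSITIVE ones, (N2-e)); every declaration whose text changes thereby — directly or through a changed declaration — is re-declared with the
suffix `O` (same namespace); unchanged declarations of the N1 file are NOT repeated (the N1 module is imported). Docstrings/citations are N1's.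
N1 HEADER (kept for the reader):
* §0 `KNCells.KSchA.hreach_of_chain_src_sub`, `Skel.reach_of_reachOblAtHN_src`, `Skelφ.kitAtRun_of_oblRHNMW_src` — the corridor
  packaging with the chain hypothesis in SOURCE-SEPARATED shape (source at `S.δc`, kits at `δ`, no `δc ≤ δ`);
* §1 **`PlanarSkeletonNeg.samePDropOfSkeletonNeg₁_of_residuesNOWA`** — the residue-level closure, re-ordered.
The choice-level packaging (`ConstsA`, `ChoiceFnNOA`, `…_of_choiceFnNOWA`) is the companion file `SkelNeg1ChoiceA`.
[cite: KozmaNitzan2024, §4 Theorem 6 (pp. 25–31), Lemmas 10–12; §1 p. 2 (approach 1)] [cite: MartineauTassion2017, §3.4] [this work]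
-/
noncomputable section

open MeasureTheory ProbabilityTheory
open scoped ENNReal Classical

namespace Summit.CriticalPhenomena.PercolationContinuityZ3.Theorems.Transplant

open Literature.Probability.Percolation Literature.Probability.LatticeModels SimpleGraph KNCells KNLevels
open Literature.Barriers.CriticalPhenomena (HasExponentialGrowth)

/-! ## §0 The corridor packaging with a source-separated chain hypothesis -/

namespace KNCells.KSchA

open GadgetSystem ProbeHistory HSiteScheme Contour

variable {V : Type*} [DecidableEq V] [Countable V] {A : Type*} {G : SimpleGraph V} [G.LocallyFinite] {S : KSchA V A} {FD : FaceData V A}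
variable {h : ProbeHistory V} {e : Site 2 × MDir} {a' : A} {du : MDir}

/-- **Lemma 12 over cells with enlarged targets ⟹ `hreach`, SOURCE-SEPARATED form**: as `hreach_of_chain_edge_subO`, but the chain
hypothesis takes the source at the scheme threshold (`1 − S.δc < P(reachB)`, which is exactly KN's (32) under `Wcor`) and the kits at an
unrelated accuracy `δ` — no `δc ≤ δ`. [cite: KozmaNitzan2024, §4 Lemma 12 (pp. 23–25), p. 30 (Step IV)] [this work] -/
theorem hreach_of_chain_src_subO (G' : SimpleGraph V) [G'.LocallyFinite] (hV : S.Valid₂O G h e) {Δ' : ℕ} {δ ε'' η : ℝ} {n : ℕ}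
    (hchain : ∀ (W : Sym2 V → unitInterval) (s : Fin (n + 1) → KNLevels.TStep G') (T' : Fin (n + 1) → Finset V) (η : ℝ),
      (∀ i : Fin (n + 1), (s i).L.o = (s 0).L.o) →
      (∀ i : Fin n, T' (Fin.castSucc i) ⊆ (s i.succ).L.X 0) →
      (∀ i : Fin (n + 1), T' i ⊆ (s i).T) →
      (∀ i : Fin (n + 1), (s i).KitsAt W S.p Δ' δ) →
      η ≤ δ / 2 →
      (∀ i : Fin (n + 1), (prodBernoulli W).real (⋃ t ∈ (s i).T \ T' i, openConn (s 0).L.o t) ≤ η) →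
      1 - S.δc < (prodBernoulli W).real (s 0).L.reachB →
        1 - ε'' < (prodBernoulli W).real (⋃ t ∈ T' (Fin.last n), openConn (s 0).L.o t))
    (s : Fin (n + 1) → KNLevels.TStep G') (T' : Fin (n + 1) → Finset V) (ho : ∀ i : Fin (n + 1), (s i).L.o = S.Γ.root)
    (hlink : ∀ i : Fin n, T' (Fin.castSucc i) ⊆ (s i.succ).L.X 0) (hsub : ∀ i : Fin (n + 1), T' i ⊆ (s i).T)
    (hkits : ∀ i : Fin (n + 1), (s i).KitsAt (S.Wcor G FD h e (S.aOf₁O G h e) a' du) S.p Δ' δ) (hη : η ≤ δ / 2)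
    (hexc : ∀ i : Fin (n + 1), (prodBernoulli (S.Wcor G FD h e (S.aOf₁O G h e) a' du)).real
      (⋃ t ∈ (s i).T \ T' i, openConn S.Γ.root t) ≤ η)
    (hB0 : S.Γ.M (S.aOf₁O G h e) (tgt e) ⊆ (s 0).L.X 0) (hTn : T' (Fin.last n) ⊆ S.Γ.M a' (tgt e + stepVec du)) :
    1 - ε'' < (prodBernoulli (S.Wfull G h e (S.aOf₁O G h e) a' du)).real (S.Reach G FD h e (S.aOf₁O G h e) a' du) := by
  set α := S.aOf₁O G h e with hα
  have hroot : S.Γ.root ∈ S.Ucor G FD h e α a' du := Finset.mem_union_left _ (Finset.mem_union_left _ hV.root_mem)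
  have ho' : ∀ i : Fin (n + 1), (s i).L.o = (s 0).L.o := fun i => by rw [ho i, ho 0]
  have hsrc : 1 - S.δc < (prodBernoulli (S.Wcor G FD h e α a' du)).real (s 0).L.reachB := by
    have := lt_real_reachB_WcorO hV hroot hB0 (a' := a') (du := du)
    rw [KNLevels.LData.reachB, ho 0]
    exact this
  have hexc' : ∀ i : Fin (n + 1), (prodBernoulli (S.Wcor G FD h e α a' du)).real
      (⋃ t ∈ (s i).T \ T' i, openConn (s 0).L.o t) ≤ η := fun i => by rw [ho 0]; exact hexc i
  have hc := hchain _ s T' η ho' hlink hsub hkits hη hexc' hsrc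
  rw [ho 0, Wcor, ← Finset.set_biUnion_coe, prodBernoulli_restrW_real_biUnion_openConn _ _ (Finset.mem_coe.2 hroot)] at hc
  refine hc.trans_le (measureReal_mono ?_ (measure_ne_top _ _))
  rw [Reach, Ucor]
  exact biUnion_openConnIn_mono subset_rfl _ (Finset.coe_subset.2 hTn)

end KNCells.KSchA

namespace Skel

open GadgetSystem ProbeHistory HSiteScheme Contour

variable {V : Type} [DecidableEq V] [Countable V] {G : SimpleGraph V} [G.LocallyFinite] {A : Type*}
variable {S : KSchA V A} {FD : FaceData V A} {h : ProbeHistory V} {e : Site 2 × MDir} {a' : A} {du : MDir}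

/-- **The corridor obligation ⟹ `Reach`, source-separated**: `ReachOblAtHNO G nmax … δ` (a chain of `n + 1 ≤ nmax + 1` steps in a habitat
window graph, kits at `δ`, excess `≤ η ≤ δ/2`) and, for every `n ≤ nmax`, the chain property with the source at `S.δc`, the kits at `δ`
and conclusion `ε''` ⟹ `1 − ε'' < P_μ(Reach)`.  No relation between `δc` and `δ`. [cite: KozmaNitzan2024, §4 p. 30 (Step IV), Lemma 12]
[this work] -/
theorem reach_of_reachOblAtHN_srcO {nmax : ℕ} (hV : S.Valid₂O G h e) {Δ' : ℕ} {δ ε'' : ℝ}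
    (hchain : ∀ n ≤ nmax, ∀ (Ω : Finset V) (Wg : Sym2 V → unitInterval) (s : Fin (n + 1) → KNLevels.TStep (winGraphIn G Ω))
      (T' : Fin (n + 1) → Finset V) (η : ℝ),
      (∀ i : Fin (n + 1), (s i).L.o = (s 0).L.o) →
      (∀ i : Fin n, T' (Fin.castSucc i) ⊆ (s i.succ).L.X 0) →
      (∀ i : Fin (n + 1), T' i ⊆ (s i).T) →
      (∀ i : Fin (n + 1), (s i).KitsAt Wg S.p Δ' δ) →
      η ≤ δ / 2 →
      (∀ i : Fin (n + 1), (prodBernoulli Wg).real (⋃ t ∈ (s i).T \ T' i, openConn (s 0).L.o t) ≤ η) →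
      1 - S.δc < (prodBernoulli Wg).real (s 0).L.reachB →
        1 - ε'' < (prodBernoulli Wg).real (⋃ t ∈ T' (Fin.last n), openConn (s 0).L.o t))
    (hR : ReachOblAtHNO G nmax S FD Δ' δ h e a' du) :
    1 - ε'' < (prodBernoulli (S.Wfull G h e (S.aOf₁O G h e) a' du)).real (S.Reach G FD h e (S.aOf₁O G h e) a' du) := by
  obtain ⟨n, hn, Ω, s, T', η, ho, hlink, hsub, hkits, hη, hexc, hB0, hTn⟩ := hR
  exact KNCells.KSchA.hreach_of_chain_src_subO (winGraphIn G Ω) hV (hchain n hn Ω) s T' ho hlink hsub hkits hη hexc hB0 hTn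

end Skel

namespace Skelφ

open GadgetSystem ProbeHistory HSiteScheme Contour
open Skel (winGraph winGraphIn RootOblTW RootOblTWO ReachOblRHN ReachOblRHNO)

variable {V : Type} [DecidableEq V] [Countable V] {G : SimpleGraph V} [G.LocallyFinite] {A : Type*}

/-- **The run-restricted obligations from the residues, root residue law-carrying, corridor chains SOURCE-SEPARATED** (twin of
`kitAtRun_of_oblRHNMWO`: the corridor chain property takes the source at `S.δc` and the kits at `δ`, unrelated).
[cite: KozmaNitzan2024, §4 (30), (32), Lemmas 10–12] [this work] -/
theorem kitAtRun_of_oblRHNMW_srcO {S : KSchA V A} {FD : FaceData V A} {nmax Δ' : ℕ} {δ δ₂ ε'' : ℝ} {δr : ℕ → ℝ}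
    (hstep : ∀ (c : V) (Rπ : ℕ) (Wg : Sym2 V → unitInterval) (s : KNLevels.TStep (winGraph G c Rπ)), s.KitsAt Wg S.p Δ' δ₂ →
      1 - δ₂ < (prodBernoulli Wg).real s.L.reachB → 1 - S.δc / 2 < (prodBernoulli Wg).real (⋃ t ∈ s.T, openConn s.L.o t))
    (hchain : ∀ n ≤ nmax, ∀ (Ω : Finset V) (Wg : Sym2 V → unitInterval) (s : Fin (n + 1) → KNLevels.TStep (winGraphIn G Ω))
      (T' : Fin (n + 1) → Finset V) (η : ℝ),
      (∀ i : Fin (n + 1), (s i).L.o = (s 0).L.o) →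
      (∀ i : Fin n, T' (Fin.castSucc i) ⊆ (s i.succ).L.X 0) →
      (∀ i : Fin (n + 1), T' i ⊆ (s i).T) →
      (∀ i : Fin (n + 1), (s i).KitsAt Wg S.p Δ' δ) →
      η ≤ δ / 2 →
      (∀ i : Fin (n + 1), (prodBernoulli Wg).real (⋃ t ∈ (s i).T \ T' i, openConn (s 0).L.o t) ≤ η) →
      1 - S.δc < (prodBernoulli Wg).real (s 0).L.reachB →
        1 - ε'' < (prodBernoulli Wg).real (⋃ t ∈ T' (Fin.last n), openConn (s 0).L.o t))
    (hchainr : ∀ (n : ℕ) (c : V) (Rπ : ℕ) (Wg : Sym2 V → unitInterval) (s : Fin (n + 1) → KNLevels.TStep (winGraph G c Rπ))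
      (T' : Fin (n + 1) → Finset V) (η : ℝ),
      (∀ i : Fin (n + 1), (s i).L.o = (s 0).L.o) →
      (∀ i : Fin n, T' (Fin.castSucc i) ⊆ (s i.succ).L.X 0) →
      (∀ i : Fin (n + 1), T' i ⊆ (s i).T) →
      (∀ i : Fin (n + 1), (s i).KitsAt Wg S.p Δ' (δr n)) →
      η ≤ δr n / 2 →
      (∀ i : Fin (n + 1), (prodBernoulli Wg).real (⋃ t ∈ (s i).T \ T' i, openConn (s 0).L.o t) ≤ η) →
      1 - δr n < (prodBernoulli Wg).real (s 0).L.reachB →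
        1 - S.δc < (prodBernoulli Wg).real (⋃ t ∈ T' (Fin.last n), openConn (s 0).L.o t))
    (hQ0 : RootOblTWO G S Δ' δr) (hface : FaceOblRMO G S FD Δ' δ₂) (hreach : ReachOblRHNO G nmax S FD Δ' δ) :
    KSchA.KitAtRunO G S FD δ₂ ε'' := by
  refine And.intro (Skel.rootObl_of_rootOblTWO hchainr hQ0) (And.intro ?_ ?_)
  · intro h e hrun hc hV du hdu j hj o hsrc
    obtain ⟨ψ', hlipψ', hF⟩ := hface h e hrun hc hV du hdu j hj o
    exact cond_of_faceOblAt hlipψ' hstep hF hsrc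
  · intro h e hrun hc hV du hdu
    exact Skel.reach_of_reachOblAtHN_srcO hV hchain (hreach h e hrun hc hV du hdu)

end Skelφ

end Summit.CriticalPhenomena.PercolationContinuityZ3.Theorems.Transplant
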